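import Literature.NumberTheory.DiophantineGeometry.ShuteFourSquareful

/-!
# Shute (2021), §3: Proposition 3.2 implies Proposition 3.1 (the dyadic decomposition)

Proofs accompanying `Literature.NumberTheory.DiophantineGeometry.ShuteFourSquareful` (the
statements `Shute2021_prop31`, `Shute2021_prop32` and the counting functions
`Shute2021.largeCoeffCount = M(B, D)`, `Shute2021.quadricCount = N(𝐗, 𝐘)` live there).

Source: A. Shute, *Sums of four squareful numbers*, arXiv:2104.06966 (2021), §3, the paragraph
"We explain how to deduce Proposition 3.1 from Proposition 3.2" (between Prop. 3.2 and its
proof, PDF p. 9). With `M₁(B; 𝐑) = #{𝐳 : Σ zᵢ = 0, zᵢ squareful, |zᵢ| ≤ B, Rᵢ ≤ |yᵢ| < 2Rᵢ}` one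
has `M(B, D) ≪ Σ_{𝐑 dyadic, R₁R₂R₃R₄ ≥ D} M₁(B; 𝐑)`; the conditions `|𝐳| ≤ B` and `Rᵢ ≤ |yᵢ|`
imply `|xᵢ|² ≤ B/Rᵢ³`, so `M₁(B; 𝐑) ≤ N((√(B/Rᵢ³))ᵢ, (2Rᵢ)ᵢ) ≪ B^{1+ε}(R₁R₂R₃R₄)^{-1/12}` by
Prop. 3.2, and summing over the dyadic `𝐑` gives `M(B, D) ≪ B^{1+ε} D^{-1/12}` [Shute2021, §3].

We formalize exactly this. The dyadic class of `𝐲` is `𝐞 = (⌊log₂ |yᵢ|⌋)ᵢ` (`Rᵢ = 2^{eᵢ}`,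
`Rᵢ³ = 8^{eᵢ}`); the classes that can occur form the index set
`{𝐞 : eᵢ ≤ log₂ B, 8^{eᵢ} ≤ B, D < ∏ᵢ 2^{eᵢ+1}}`; each class injects into the set counted by
`quadricCount (⌊√(B / 8^{eᵢ})⌋)ᵢ (2^{eᵢ+1})ᵢ` (`Shute2021.largeCoeffCount_le_sum_quadricCount`);
Prop. 3.2 bounds each piece by `≪ B^{1+2ε}(R₁⋯R₄)^{-1/12} ≪ B^{1+2ε} D^{-1/12}`
(`Shute2021.quadricCount_dyadic_le`); and the number `(log₂ B + 1)⁴` of classes is absorbed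
into `B^{ε}` via `log B ≤ B^δ/δ` (`Shute2021.log_two_succ_pow_four_le`; the paper sums the
geometric series instead, which only changes the constant). The outcome is the implication
`Shute2021_prop32.prop31 : Shute2021_prop32 → Shute2021_prop31`.

## Deliberately not here

* The discharge `Shute2021_prop31_holds`: it is `Shute2021_prop32.prop31 Shute2021_prop32_holds`
  once Proposition 3.2 itself (two printed pages: Hölder, two Cauchy–Schwarz steps, divisor
  bounds, `ρ(r) ≪ r^{1+ε}`) is discharged.

## References

* A. Shute, *Sums of four squareful numbers*, arXiv:2104.06966 [math.NT] (2021), §3,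
  Propositions 3.1, 3.2 and the deduction between them (PDF p. 9). [Shute2021]
-/

noncomputable section

open Finset

namespace Literature.NumberTheory.DiophantineGeometry

namespace Shute2021

/-! ### The dyadic classes `Rᵢ = 2^{eᵢ} ≤ |yᵢ| < 2Rᵢ`, `eᵢ = ⌊log₂ |yᵢ|⌋` -/

/-- `Rᵢ = 2^{⌊log₂ |yᵢ|⌋} ≤ |yᵢ|` (when `yᵢ ≠ 0`). [folklore] -/
theorem two_pow_log_le_natAbs {y : ℤ} (hy : y ≠ 0) : 2 ^ Nat.log 2 y.natAbs ≤ y.natAbs :=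
  Nat.pow_log_le_self 2 (Int.natAbs_ne_zero.2 hy)

/-- `|yᵢ| < 2Rᵢ = 2^{⌊log₂ |yᵢ|⌋ + 1}`. [folklore] -/
theorem natAbs_lt_two_pow_log_succ (y : ℤ) : y.natAbs < 2 ^ (Nat.log 2 y.natAbs + 1) :=
  Nat.lt_pow_succ_log_self one_lt_two _

/-- The size observation of the deduction: `|yᵢ³ xᵢ²| ≤ B` and `Rᵢ ≤ |yᵢ|` give `xᵢ² Rᵢ³ ≤ B`
("`|xᵢ|² ≤ B/Rᵢ³`"; in `ℕ`, with `Rᵢ³ = 8^{eᵢ}`). [cite: Shute2021, §3 (deduction of Prop. 3.1)] -/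
theorem natAbs_sq_mul_eight_pow_log_le {x y : ℤ} {B : ℕ} (hy : y ≠ 0)
    (hz : |y ^ 3 * x ^ 2| ≤ (B : ℤ)) : x.natAbs ^ 2 * 8 ^ Nat.log 2 y.natAbs ≤ B := by
  have h8 : 8 ^ Nat.log 2 y.natAbs ≤ y.natAbs ^ 3 := by
    rw [show (8 : ℕ) = 2 ^ 3 by norm_num, ← pow_mul, mul_comm, pow_mul]
    exact Nat.pow_le_pow_left (two_pow_log_le_natAbs hy) 3
  have hzB : (y ^ 3 * x ^ 2).natAbs ≤ B := by
    rw [Int.abs_eq_natAbs] at hz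
    exact_mod_cast hz
  rw [Int.natAbs_mul, Int.natAbs_pow, Int.natAbs_pow] at hzB
  calc x.natAbs ^ 2 * 8 ^ Nat.log 2 y.natAbs ≤ x.natAbs ^ 2 * y.natAbs ^ 3 :=
        Nat.mul_le_mul_left _ h8
    _ = y.natAbs ^ 3 * x.natAbs ^ 2 := mul_comm _ _
    _ ≤ B := hzB

/-- There are at most `(log₂ B + 1)⁴` dyadic classes `𝐞` with `eᵢ ≤ log₂ B`, `8^{eᵢ} ≤ B` and
`D < ∏ᵢ 2^{eᵢ+1}`. [folklore] -/
theorem card_dyadicIndex_le (B D : ℕ) :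
    #{e ∈ Fintype.piFinset fun _ : Fin 4 => Finset.range (Nat.log 2 B + 1) |
        (∀ i, 8 ^ e i ≤ B) ∧ D < ∏ i, 2 ^ (e i + 1)} ≤ (Nat.log 2 B + 1) ^ 4 := by
  refine (Finset.card_filter_le _ _).trans ?_
  rw [Fintype.card_piFinset, Finset.prod_const, Finset.card_range, Finset.card_univ,
    Fintype.card_fin]

open Classical in
/-- **`M(B, D) ≤ Σ_𝐑 M₁(B; 𝐑) ≤ Σ_𝐑 N((√(B/Rᵢ³))ᵢ, (2Rᵢ)ᵢ)`**: splitting the solutions counted by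
`M(B, D)` according to the dyadic class `𝐞 = (⌊log₂ |yᵢ|⌋)ᵢ` of `𝐲` (`Rᵢ = 2^{eᵢ}`), each piece
lies in the set counted by `N(𝐗, 𝐘)` with `Xᵢ = ⌊√(B / 8^{eᵢ})⌋`, `Yᵢ = 2^{eᵢ+1}`, and only the
classes with `eᵢ ≤ log₂ B`, `8^{eᵢ} ≤ B` and `D < ∏ᵢ 2^{eᵢ+1}` occur.
[cite: Shute2021, §3 (deduction of Prop. 3.1)] -/
theorem largeCoeffCount_le_sum_quadricCount (B D : ℕ) :
    largeCoeffCount B D ≤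
      ∑ e ∈ Fintype.piFinset (fun _ : Fin 4 => Finset.range (Nat.log 2 B + 1)) with
          (∀ i, 8 ^ e i ≤ B) ∧ D < ∏ i, 2 ^ (e i + 1),
        quadricCount (fun i => Nat.sqrt (B / 8 ^ e i)) (fun i => 2 ^ (e i + 1)) := by
  unfold largeCoeffCount
  rw [Finset.card_eq_sum_card_fiberwise
    (f := fun p : (Fin 4 → ℤ) × (Fin 4 → ℤ) => fun i => Nat.log 2 (p.2 i).natAbs)
    (t := {e ∈ Fintype.piFinset fun _ : Fin 4 => Finset.range (Nat.log 2 B + 1) |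
        (∀ i, 8 ^ e i ≤ B) ∧ D < ∏ i, 2 ^ (e i + 1)}) ?maps]
  · refine Finset.sum_le_sum fun e _ => ?_
    unfold quadricCount
    refine Finset.card_le_card fun p hp => ?_
    rw [Finset.mem_filter] at hp
    obtain ⟨hp, hpe⟩ := hp
    rw [Finset.mem_filter] at hp
    obtain ⟨-, hcond, -, hsum, -⟩ := hp
    subst hpe
    rw [Finset.mem_filter, Finset.mem_product, mem_box, mem_box]
    refine ⟨⟨fun i => ?_, fun i => ?_⟩,
      fun i => ⟨(hcond i).1.ne', (hcond i).2.1, (hcond i).2.2.1⟩, ?_⟩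
    · -- `|xᵢ| ≤ ⌊√(B / 8^{eᵢ})⌋`
      obtain ⟨-, hy, -, hz⟩ := hcond i
      have hX : (p.1 i).natAbs ≤ Nat.sqrt (B / 8 ^ Nat.log 2 (p.2 i).natAbs) := by
        rw [Nat.le_sqrt, ← pow_two, Nat.le_div_iff_mul_le (by positivity)]
        exact natAbs_sq_mul_eight_pow_log_le hy hz
      rw [Int.abs_eq_natAbs]
      exact_mod_cast hX
    · -- `|yᵢ| ≤ 2^{eᵢ+1}`
      rw [Int.abs_eq_natAbs]
      exact_mod_cast (natAbs_lt_two_pow_log_succ (p.2 i)).le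
    · rw [← hsum]
      exact Finset.sum_congr rfl fun i _ => mul_comm _ _
  · -- every solution lies in an admissible dyadic class
    intro p hp
    rw [Finset.mem_coe, Finset.mem_filter, Finset.mem_product, mem_box, mem_box] at hp
    obtain ⟨⟨-, hyB⟩, hcond, -, -, hD⟩ := hp
    simp only [Finset.coe_filter, Set.mem_setOf_eq, Fintype.mem_piFinset, Finset.mem_range]
    refine ⟨fun i => ?_, fun i => ?_, ?_⟩
    · -- `eᵢ ≤ log₂ B`
      have h1 : (p.2 i).natAbs ≤ B := by
        have := hyB i
        rw [Int.abs_eq_natAbs] at this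
        exact_mod_cast this
      exact Nat.lt_succ_of_le (Nat.log_mono_right h1)
    · -- `8^{eᵢ} ≤ xᵢ² 8^{eᵢ} ≤ B`
      obtain ⟨hx, hy, -, hz⟩ := hcond i
      have hx1 : 1 ≤ (p.1 i).natAbs ^ 2 := Nat.one_le_pow _ _ (Int.natAbs_pos.2 hx.ne')
      exact (Nat.le_mul_of_pos_left _ hx1).trans (natAbs_sq_mul_eight_pow_log_le hy hz)
    · -- `D ≤ |∏ yᵢ| = ∏ |yᵢ| < ∏ 2^{eᵢ+1}`
      have hprod : ∏ i, |p.2 i| < ∏ i, ((2 ^ (Nat.log 2 (p.2 i).natAbs + 1) : ℕ) : ℤ) :=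
        Finset.prod_lt_prod_of_nonempty (fun i _ => abs_pos.2 (hcond i).2.1)
          (fun i _ => by
            rw [Int.abs_eq_natAbs]
            exact_mod_cast natAbs_lt_two_pow_log_succ (p.2 i))
          Finset.univ_nonempty
      rw [Finset.abs_prod] at hD
      exact_mod_cast hD.trans_lt hprod

/-! ### The real-variable bookkeeping -/

/-- Counting the dyadic classes: `(log₂ B + 1)⁴ ≤ (1/(δ log 2) + 1)⁴ B^{4δ}` for every `δ > 0`,
from `log B ≤ B^δ / δ` (`Real.log_le_rpow_div`). [folklore] -/
theorem log_two_succ_pow_four_le {δ : ℝ} (hδ : 0 < δ) {B : ℕ} (hB : 1 ≤ B) :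
    ((Nat.log 2 B + 1 : ℕ) : ℝ) ^ 4 ≤ (1 / (δ * Real.log 2) + 1) ^ 4 * (B : ℝ) ^ (4 * δ) := by
  have hB0 : (0 : ℝ) < B := by exact_mod_cast hB
  have hlog2 : 0 < Real.log 2 := Real.log_pos one_lt_two
  have h2L : 2 ^ Nat.log 2 B ≤ B := Nat.pow_log_le_self 2 (by omega)
  have hL : (Nat.log 2 B : ℝ) * Real.log 2 ≤ Real.log B := by
    rw [← Real.log_pow]
    exact Real.log_le_log (by positivity) (by exact_mod_cast h2L)
  have hlog : Real.log B ≤ (B : ℝ) ^ δ / δ := Real.log_le_rpow_div hB0.le hδ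
  have hBδ : 1 ≤ (B : ℝ) ^ δ := Real.one_le_rpow (by exact_mod_cast hB) hδ.le
  have hL' : (Nat.log 2 B : ℝ) ≤ (B : ℝ) ^ δ / δ / Real.log 2 := by
    rw [le_div_iff₀ hlog2]
    exact hL.trans hlog
  have h1 : ((Nat.log 2 B + 1 : ℕ) : ℝ) ≤ (1 / (δ * Real.log 2) + 1) * (B : ℝ) ^ δ := by
    push_cast
    calc (Nat.log 2 B : ℝ) + 1 ≤ (B : ℝ) ^ δ / δ / Real.log 2 + (B : ℝ) ^ δ := add_le_add hL' hBδ
      _ = (1 / (δ * Real.log 2) + 1) * (B : ℝ) ^ δ := by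
        field_simp
  have h0 : (0 : ℝ) ≤ ((Nat.log 2 B + 1 : ℕ) : ℝ) := by positivity
  calc ((Nat.log 2 B + 1 : ℕ) : ℝ) ^ 4 ≤ ((1 / (δ * Real.log 2) + 1) * (B : ℝ) ^ δ) ^ 4 :=
        pow_le_pow_left₀ h0 h1 4
    _ = (1 / (δ * Real.log 2) + 1) ^ 4 * (B : ℝ) ^ (4 * δ) := by
        rw [mul_pow, mul_comm (4 : ℝ) δ, Real.rpow_mul hB0.le]
        norm_num

/-- Exponent bookkeeping for one dyadic piece: if `Q² P³ ≤ B⁴` (`Q = ∏ Xᵢ`, `P = ∏ Rᵢ ≥ 1`), then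
`Q^{1/2+ε} (16P)^{2/3+ε} ≤ 16^{2/3+ε} B^{1+2ε} P^{-1/12}`
(`(B²P^{-3/2})^{1/2+ε}(16P)^{2/3+ε} = 16^{2/3+ε} B^{1+2ε} P^{-1/12-ε/2}`). [folklore] -/
theorem dyadic_piece_bound {Q P B ε : ℝ} (hQ : 0 ≤ Q) (hP : 1 ≤ P) (hB : 0 < B) (hε : 0 < ε)
    (hQP : Q ^ 2 * P ^ 3 ≤ B ^ 4) :
    Q ^ (1 / 2 + ε) * (16 * P) ^ (2 / 3 + ε) ≤
      (16 : ℝ) ^ (2 / 3 + ε) * B ^ (1 + 2 * ε) * P ^ (-(1 / 12 : ℝ)) := by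
  have hP0 : 0 < P := one_pos.trans_le hP
  -- `Q ≤ B² P^{-3/2}`
  have hQle : Q ≤ B ^ 2 * P ^ (-(3 / 2 : ℝ)) := by
    have hsq : (B ^ 2 * P ^ (-(3 / 2 : ℝ))) ^ 2 = B ^ 4 / P ^ 3 := by
      have h3 : (P ^ (-(3 / 2 : ℝ))) ^ 2 = (P ^ 3)⁻¹ := by
        rw [← Real.rpow_natCast (P ^ (-(3 / 2 : ℝ))) 2, ← Real.rpow_mul hP0.le,
          show (-(3 / 2 : ℝ)) * ((2 : ℕ) : ℝ) = -((3 : ℕ) : ℝ) by norm_num, Real.rpow_neg hP0.le,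
          Real.rpow_natCast]
      rw [mul_pow, h3, div_eq_mul_inv]
      ring
    have h2 : Q ^ 2 ≤ (B ^ 2 * P ^ (-(3 / 2 : ℝ))) ^ 2 := by
      rw [hsq, le_div_iff₀ (by positivity)]
      exact hQP
    exact (pow_le_pow_iff_left₀ hQ (by positivity) two_ne_zero).1 h2
  have hε1 : 0 ≤ 1 / 2 + ε := by positivity
  calc Q ^ (1 / 2 + ε) * (16 * P) ^ (2 / 3 + ε)
      ≤ (B ^ 2 * P ^ (-(3 / 2 : ℝ))) ^ (1 / 2 + ε) * (16 * P) ^ (2 / 3 + ε) := by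
        gcongr
    _ = (16 : ℝ) ^ (2 / 3 + ε) * B ^ (1 + 2 * ε) * P ^ (-(1 / 12 : ℝ) - ε / 2) := by
        rw [Real.mul_rpow (by positivity) (by positivity), Real.mul_rpow (by norm_num) hP0.le,
          ← Real.rpow_mul hP0.le, show (B ^ 2 : ℝ) = B ^ (2 : ℝ) by norm_cast,
          ← Real.rpow_mul hB.le]
        have e1 : (2 : ℝ) * (1 / 2 + ε) = 1 + 2 * ε := by ring
        have e2 : P ^ (-(3 / 2 : ℝ) * (1 / 2 + ε)) * P ^ (2 / 3 + ε) =
            P ^ (-(1 / 12 : ℝ) - ε / 2) := by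
          rw [← Real.rpow_add hP0]
          congr 1
          ring
        rw [e1, ← e2]
        ring
    _ ≤ (16 : ℝ) ^ (2 / 3 + ε) * B ^ (1 + 2 * ε) * P ^ (-(1 / 12 : ℝ)) := by
        gcongr
        linarith

/-- **One dyadic piece** (`M₁(B; 𝐑) ≪ B^{1+ε}(R₁⋯R₄)^{-1/12}` and `R₁⋯R₄ > D/16`): if
`8^{eᵢ} ≤ B` for all `i` and `D < ∏ᵢ 2^{eᵢ+1}`, then Prop. 3.2 with exponent `ε` and constant
`C` gives `N((⌊√(B/8^{eᵢ})⌋)ᵢ, (2^{eᵢ+1})ᵢ) ≤ C · 16^{2/3+ε} · 16^{1/12} · B^{1+2ε} · D^{-1/12}`.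
[cite: Shute2021, §3 (deduction of Prop. 3.1)] -/
theorem quadricCount_dyadic_le {ε C : ℝ} (hε : 0 < ε)
    (hN : ∀ X Y : Fin 4 → ℕ, (∀ i, 1 ≤ X i) → (∀ i, 1 ≤ Y i) →
      (quadricCount X Y : ℝ) ≤ C * (∏ i, (X i : ℝ)) ^ (1 / 2 + ε) * (∏ i, (Y i : ℝ)) ^ (2 / 3 + ε))
    {B D : ℕ} (hB : 1 ≤ B) (hD : 1 ≤ D) {e : Fin 4 → ℕ} (h8 : ∀ i, 8 ^ e i ≤ B)
    (hDlt : D < ∏ i, 2 ^ (e i + 1)) :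
    (quadricCount (fun i => Nat.sqrt (B / 8 ^ e i)) (fun i => 2 ^ (e i + 1)) : ℝ) ≤
      C * (16 : ℝ) ^ (2 / 3 + ε) * (16 : ℝ) ^ (1 / 12 : ℝ) * (B : ℝ) ^ (1 + 2 * ε) *
        (D : ℝ) ^ (-(1 / 12 : ℝ)) := by
  set X : Fin 4 → ℕ := fun i => Nat.sqrt (B / 8 ^ e i) with hXdef
  set Y : Fin 4 → ℕ := fun i => 2 ^ (e i + 1) with hYdef
  have hB0 : (0 : ℝ) < B := by exact_mod_cast hB
  have hD0 : (0 : ℝ) < D := by exact_mod_cast hD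
  -- the hypotheses `Xᵢ, Yᵢ ≥ 1` of Prop. 3.2
  have hX1 : ∀ i, 1 ≤ X i := fun i => by
    rw [hXdef, Nat.succ_le_iff, Nat.sqrt_pos, Nat.div_pos_iff]
    exact ⟨by positivity, h8 i⟩
  have hY1 : ∀ i, 1 ≤ Y i := fun i => Nat.one_le_two_pow
  have h1 := hN X Y hX1 hY1
  -- `P = R₁R₂R₃R₄ ≥ 1`
  set P : ℝ := ∏ i, (2 : ℝ) ^ e i with hPdef
  have hP1 : 1 ≤ P := Finset.one_le_prod fun i _ => one_le_pow₀ one_le_two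
  have hP0 : 0 < P := one_pos.trans_le hP1
  -- `Q² P³ ≤ B⁴` for `Q = ∏ Xᵢ`, from `Xᵢ² 8^{eᵢ} ≤ B`
  have hQP : (∏ i, (X i : ℝ)) ^ 2 * P ^ 3 ≤ (B : ℝ) ^ 4 := by
    have hfac : ∀ i, (X i : ℝ) ^ 2 * (8 : ℝ) ^ e i ≤ B := fun i => by
      have hsq : X i ^ 2 ≤ B / 8 ^ e i := Nat.sqrt_le' _
      exact_mod_cast (Nat.le_div_iff_mul_le (by positivity)).1 hsq
    have hprod :=
      Finset.prod_le_prod (s := Finset.univ) (fun i _ => by positivity) fun i _ => hfac i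
    rw [Finset.prod_const, Finset.card_univ, Fintype.card_fin, Finset.prod_mul_distrib,
      Finset.prod_pow] at hprod
    have h8P : ∏ i, (8 : ℝ) ^ e i = P ^ 3 := by
      rw [hPdef, ← Finset.prod_pow]
      refine Finset.prod_congr rfl fun i _ => ?_
      rw [← pow_mul, mul_comm, pow_mul]
      norm_num
    rwa [h8P] at hprod
  -- `∏ Yᵢ = 16 P`
  have hYprod : (∏ i, (Y i : ℝ)) = 16 * P := by
    have h2 : ∀ i, (Y i : ℝ) = (2 : ℝ) ^ e i * 2 := fun i => by
      simp [hYdef, pow_succ]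
    simp_rw [h2]
    rw [Finset.prod_mul_distrib, Finset.prod_const, Finset.card_univ, Fintype.card_fin, ← hPdef]
    norm_num
    ring
  -- `D / 16 ≤ P`
  have hDP : (D : ℝ) / 16 ≤ P := by
    have h16 : ((∏ i, 2 ^ (e i + 1) : ℕ) : ℝ) = 16 * P := by
      rw [← hYprod]
      simp [hYdef]
    have hlt : (D : ℝ) < 16 * P := by
      rw [← h16]
      exact_mod_cast hDlt
    rw [div_le_iff₀ (by norm_num : (0 : ℝ) < 16)]
    linarith
  have hpiece :=
    dyadic_piece_bound (Finset.prod_nonneg fun i _ => Nat.cast_nonneg _) hP1 hB0 hε hQP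
  have hC : 0 ≤ C := by
    -- `C ≥ 0` since it bounds a count for `X = Y = 1`
    have h0 := hN (fun _ => 1) (fun _ => 1) (fun _ => le_rfl) (fun _ => le_rfl)
    simp only [Nat.cast_one, Finset.prod_const_one, Real.one_rpow, mul_one] at h0
    exact (Nat.cast_nonneg _).trans h0
  calc (quadricCount X Y : ℝ)
      ≤ C * (∏ i, (X i : ℝ)) ^ (1 / 2 + ε) * (∏ i, (Y i : ℝ)) ^ (2 / 3 + ε) := h1
    _ = C * ((∏ i, (X i : ℝ)) ^ (1 / 2 + ε) * (16 * P) ^ (2 / 3 + ε)) := by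
        rw [hYprod, mul_assoc]
    _ ≤ C * ((16 : ℝ) ^ (2 / 3 + ε) * (B : ℝ) ^ (1 + 2 * ε) * P ^ (-(1 / 12 : ℝ))) := by
        gcongr
    _ ≤ C * ((16 : ℝ) ^ (2 / 3 + ε) * (B : ℝ) ^ (1 + 2 * ε) *
          ((16 : ℝ) ^ (1 / 12 : ℝ) * (D : ℝ) ^ (-(1 / 12 : ℝ)))) := by
        gcongr
        -- `P^{-1/12} ≤ (D/16)^{-1/12} = 16^{1/12} D^{-1/12}`
        calc P ^ (-(1 / 12 : ℝ)) ≤ ((D : ℝ) / 16) ^ (-(1 / 12 : ℝ)) :=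
              Real.rpow_le_rpow_of_nonpos (by positivity) hDP (by norm_num)
          _ = (16 : ℝ) ^ (1 / 12 : ℝ) * (D : ℝ) ^ (-(1 / 12 : ℝ)) := by
              rw [Real.div_rpow hD0.le (by norm_num), Real.rpow_neg (by norm_num : (0 : ℝ) ≤ 16),
                div_inv_eq_mul, mul_comm]
    _ = C * (16 : ℝ) ^ (2 / 3 + ε) * (16 : ℝ) ^ (1 / 12 : ℝ) * (B : ℝ) ^ (1 + 2 * ε) *
          (D : ℝ) ^ (-(1 / 12 : ℝ)) := by ring

end Shute2021

/-- **Proposition 3.2 ⟹ Proposition 3.1** (Shute 2021, §3): the printed deduction of the bound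
`M(B, D) = O_ε(B^{1+ε} D^{-1/12})` from `N(𝐗, 𝐘) = O_ε((X₁⋯X₄)^{1/2+ε}(Y₁⋯Y₄)^{2/3+ε})` by the
dyadic decomposition in `|yᵢ|` (`Shute2021.largeCoeffCount_le_sum_quadricCount`,
`Shute2021.quadricCount_dyadic_le` with exponent `ε/4`, and `Shute2021.log_two_succ_pow_four_le`
with `δ = ε/8`). [cite: Shute2021, §3 (deduction of Prop. 3.1 from Prop. 3.2)] -/
theorem Shute2021_prop32.prop31 (h : Shute2021_prop32) : Shute2021_prop31 := by
  intro ε hε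
  obtain ⟨C, hC, hN⟩ := h (ε / 4) (by positivity)
  have hlog2 : 0 < Real.log 2 := Real.log_pos one_lt_two
  have hK : 0 < 1 / (ε / 8 * Real.log 2) + 1 := by positivity
  refine ⟨C * (16 : ℝ) ^ (2 / 3 + ε / 4) * (16 : ℝ) ^ (1 / 12 : ℝ) *
      (1 / (ε / 8 * Real.log 2) + 1) ^ 4, by positivity, fun B D hB hD => ?_⟩
  have hB0 : (0 : ℝ) < B := by exact_mod_cast hB
  set K₁ : ℝ := C * (16 : ℝ) ^ (2 / 3 + ε / 4) * (16 : ℝ) ^ (1 / 12 : ℝ) *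
    (B : ℝ) ^ (1 + 2 * (ε / 4)) * (D : ℝ) ^ (-(1 / 12 : ℝ)) with hK₁
  have hK₁0 : 0 ≤ K₁ := by positivity
  -- the admissible dyadic classes
  set E : Finset (Fin 4 → ℕ) :=
    {e ∈ Fintype.piFinset fun _ : Fin 4 => Finset.range (Nat.log 2 B + 1) |
      (∀ i, 8 ^ e i ≤ B) ∧ D < ∏ i, 2 ^ (e i + 1)} with hE
  calc (Shute2021.largeCoeffCount B D : ℝ)
      ≤ ∑ e ∈ E, (Shute2021.quadricCount (fun i => Nat.sqrt (B / 8 ^ e i))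
          (fun i => 2 ^ (e i + 1)) : ℝ) := by
        exact_mod_cast Shute2021.largeCoeffCount_le_sum_quadricCount B D
    _ ≤ ∑ _e ∈ E, K₁ := by
        refine Finset.sum_le_sum fun e he => ?_
        rw [hE, Finset.mem_filter] at he
        exact Shute2021.quadricCount_dyadic_le (by positivity) hN hB hD he.2.1 he.2.2
    _ = #E * K₁ := by rw [Finset.sum_const, nsmul_eq_mul]
    _ ≤ ((Nat.log 2 B + 1) ^ 4 : ℕ) * K₁ := by
        gcongr
        exact_mod_cast Shute2021.card_dyadicIndex_le B D
    _ ≤ (1 / (ε / 8 * Real.log 2) + 1) ^ 4 * (B : ℝ) ^ (4 * (ε / 8)) * K₁ := by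
        gcongr
        push_cast
        exact_mod_cast Shute2021.log_two_succ_pow_four_le (by positivity : 0 < ε / 8) hB
    _ = C * (16 : ℝ) ^ (2 / 3 + ε / 4) * (16 : ℝ) ^ (1 / 12 : ℝ) *
          (1 / (ε / 8 * Real.log 2) + 1) ^ 4 * (B : ℝ) ^ (1 + ε) * (D : ℝ) ^ (-(1 / 12 : ℝ)) := by
        have hBpow : (B : ℝ) ^ (4 * (ε / 8)) * (B : ℝ) ^ (1 + 2 * (ε / 4)) = (B : ℝ) ^ (1 + ε) := by
          rw [← Real.rpow_add hB0]
          congr 1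
          ring
        rw [hK₁, ← hBpow]
        ring

end Literature.NumberTheory.DiophantineGeometry
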